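import Summits.FinalStateConjecture.FinalStateConjecture.Theorems.ClusterCompletenessOmegaLimitMultiKerrStationaryOmegaLimits
import Summits.FinalStateConjecture.FinalStateConjecture.Theorems.ClusterCompletenessOmegaLimitMultiKerrKillingDefectFlux
import Summits.FinalStateConjecture.FinalStateConjecture.Theorems.ClusterCompletenessOmegaLimitMultiKerrLimitRegularity
import HarnessLib

/-!
# Route ClusterCompleteness · crux `OmegaLimitMultiKerr` — the headline made EXPLICIT:
# TAME + a transfer inequality for the KILLING-DEFECT FLUX ⇒ asymptotically stationary development

Structure lemma for the crux stmt-FinalStateConjecture-14664 (`ClusterCompleteness.OmegaLimitMultiKerr`,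
rank 9), line `Sketch`, lead gen 5, registered stub
`tendsto_supCkENorm_fderiv_translate_of_killingDefect_transfer` (closed form).

`tendsto_supCkENorm_fderiv_translate_of_transfer` (`…StationaryOmegaLimits`, p128262) isolates the
physics of the LaSalle line in ONE hypothesis — a transfer inequality for SOME family of local fluxes
with four abstract properties (nonnegative and continuous in time along the orbit, continuous along
`C^{k+1}_loc`-convergent sequences of translates, continuous along the translates of `C^{k+1}`
fields, definite for `∂ₑ`). This file discharges the four properties for the CONCRETE flux
`Φ_K f = sup_{x ∈ K} min (1, ‖Df(x) e‖)` ("Killing-defect flux": the truncated size over `K` of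
the derivative along the background's Killing translation; `…KillingDefectFlux`), using
`…LimitRegularity` (under tameness no junk field can be a limit of translates, so the continuity
hypothesis only ever meets `C^{k+1}` limits), and states the result with the transfer inequality as
its ONLY non-structural hypothesis:

**Theorem.** `h ∈ C^{k+2}(O)`, `O` open and `e`-invariant in a finite-dimensional space, TAME
(all-late-time `C^{k+2}` bounds on the translates of every compact); `Kx j` compact, `⊆ O`, covering
`O`; for each `j` a window width `L j > 0`, lag `c j`, constant `C' j` and error `err j → 0` with
`∫_{[t, t + L j]} sup_{x ∈ Kx j} min (1, ‖D h(x + s e) e‖) ds ≤ C' j · (M (t − c j) − M (t + L j + c j)) + err j t`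
for `t ≥ a`, where `M : ℝ → ℝ` converges (final Bondi mass). THEN
`supCkENorm K k (x ↦ D h (x + t e) e) → 0` as `t → +∞` for every compact `K ⊆ O`.

In words: if the defect of stationarity in every compact chart region is paid for, window by window,
by the mass radiated through null infinity, then the charted geometry becomes stationary along the
background's Killing time, in `Cᵏ` on compacts. LaSalle 1960; Hale 1980, Ch. X §1. Everything
is proved; no definitions; the transfer inequality itself is NOT claimed (it is the physics input
(P1) of the identification stub, `Lines/Sketch.md`, gen 5).
-/

-- every `Summit.FinalStateConjecture.FinalStateConjecture.…` name repeats the summit = sub-problem segment (D-0017 layout)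
set_option linter.dupNamespace false

noncomputable section

open Set Filter Topology Function
open scoped ContDiff Topology ENNReal

namespace Summit.FinalStateConjecture.FinalStateConjecture.Theorems.ClusterCompleteness

open Literature.Geometry.Lorentzian MeasureTheory

/-- **Tame + Killing-defect transfer ⇒ asymptotically stationary** (registered structure stub of
line `Sketch`, crux stmt-FinalStateConjecture-14664; closed form; see the module docstring).
[cite: Hale1980, Ch. X §1] -/
theorem tendsto_supCkENorm_fderiv_translate_of_killingDefect_transfer :
    ∀ {E : Type*} [NormedAddCommGroup E] [NormedSpace ℝ E] [FiniteDimensional ℝ E]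
      {W : Type*} [NormedAddCommGroup W] [NormedSpace ℝ W] [FiniteDimensional ℝ W]
      {O : Set E} {e : E}, IsOpen O → (∀ x ∈ O, ∀ s : ℝ, x + s • e ∈ O) →
      ∀ {k : ℕ} {h : E → W}, ContDiffOn ℝ (k + 2) h O →
      (∀ K ⊆ O, IsCompact K → ∃ Λ a : ℝ, ∀ t : ℝ, a ≤ t → ∀ i, i ≤ k + 2 → ∀ z ∈ K,
        ‖iteratedFDeriv ℝ i h (z + t • e)‖ ≤ Λ) →
      ∀ (Kx : ℕ → Set E), (∀ j, IsCompact (Kx j)) → (∀ j, Kx j ⊆ O) → O ⊆ ⋃ j, Kx j →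
      ∀ (M : ℝ → ℝ) (err : ℕ → ℝ → ℝ) (L c C' : ℕ → ℝ) {a Mf : ℝ}, (∀ j, 0 < L j) →
      (∀ j, ∀ t ∈ Ici a, ∫ s in Icc t (t + L j),
          sSup ((fun x ↦ min 1 ‖fderiv ℝ (fun y ↦ h (y + s • e)) x e‖) '' Kx j) ≤
        C' j * (M (t - c j) - M (t + L j + c j)) + err j t) →
      Tendsto M atTop (𝓝 Mf) → (∀ j, Tendsto (err j) atTop (𝓝 0)) →
      ∀ K ⊆ O, IsCompact K →
        Tendsto (fun t : ℝ ↦ supCkENorm K k (fun x ↦ fderiv ℝ h (x + t • e) e)) atTop (𝓝 0) := by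
  intro E _ _ _ W _ _ _ O e hO hOe k h hh htame Kx hKc hKO hcov M err L c C' a Mf hL htr hM herr
    K hKKO hK
  -- `h` is `C¹` on `O`
  have hh1 : ContDiffOn ℝ 1 h O := hh.of_le (by norm_cast; omega)
  refine tendsto_supCkENorm_fderiv_translate_of_transfer hO hOe hh htame Kx hcov
    (fun j f ↦ sSup ((fun x ↦ min 1 ‖fderiv ℝ f x e‖) '' Kx j)) (a := a)
    (fun j t _ ↦ sSup_min_norm_fderiv_apply_nonneg) (fun j ↦ ?_) (fun j t g' ht hconv ↦ ?_)
    (fun g j hg ↦ ?_) (fun g j _ h0 y hy _ ↦ ?_) M err L c C' hL htr hM herr K hKKO hK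
  · -- continuity in time along the orbit
    exact (continuous_sSup_min_norm_fderiv_apply_translate hO hOe (hKO j) (hKc j) hh1).continuousOn
  · -- continuity along `C^{k+1}_loc`-convergent sequences of translates: the limit is regular …
    have hg' : ContDiffOn ℝ (k + 1) g' O :=
      contDiffOn_of_tendsto_supCkENorm_translate_sub hO hOe hh htame ht hconv
    -- … so the concrete flux converges
    have hf : ∀ n, ContDiffOn ℝ 1 (fun x ↦ h (x + t n • e)) O := fun n ↦
      (hh1.comp ((contDiff_id.add contDiff_const).contDiffOn) fun x hx ↦ hOe x hx _)
    exact tendsto_sSup_min_norm_fderiv_apply_of_tendsto_supCkENorm hO (hKO j) (hKc j) hf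
      (hg'.of_le (by norm_cast; omega)) (hconv (Kx j) (hKO j) (hKc j))
  · -- continuity along the translates of a `C^{k+1}` field
    exact continuous_sSup_min_norm_fderiv_apply_translate hO hOe (hKO j) (hKc j)
      (hg.of_le (by norm_cast; omega))
  · -- definiteness for `∂ₑ`
    exact fderiv_apply_eq_zero_of_sSup_min_norm_fderiv_apply_eq_zero h0 y hy

end Summit.FinalStateConjecture.FinalStateConjecture.Theorems.ClusterCompleteness

end
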